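import Literature.NumberTheory.LFunctions.ConnesProlateGuessError
import HarnessLib

/-!
# Connes' Fact 6.4 from prolate asymptotics: the limit argument

Connes 2026 (*The Riemann Hypothesis: past, present and a letter through time*, arXiv:2602.04022),
Fact 6.4 = Connes–Consani–Moscovici 2025 (*Zeta spectral triples*, arXiv:2511.22755), Lemma 7.3:
the Fourier (here: Mellin) transform of the prolate guess `k_λ = 𝓔(h_λ)|_{[λ^{-1},λ]}` converges to
Riemann's `Ξ` (here: `ξ(½+s)`) uniformly on closed substrips of the open critical strip.  The tree
carries the statement as the named fact `prolateGuess_tendsto_riemannXi` (file `ConnesProlateGuess.lean`).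

The file `ConnesProlateGuessError.lean` proves, WITHOUT any hypothesis beyond `h_{0,λ}, h_{4,λ}` being
prolate functions (`IsProlateFunction`), the `s`-free bound
(`norm_four_mul_prolateGuessMellin_sub_riemannXi_le_W11`): for `λ ≥ 1`, `0 ≤ α₀ < ½`, `|Re s| ≤ α₀`,

  `‖4M_λ(s) − ξ(½+s)‖ ≤ 4(¼−α₀²)^{-1}·(|h_λ(λ)|λ + ∫_0^λ |h_λ′ − h′|(x)(x^{½−α₀} + x^{½+α₀})dx
        + ∫_λ^∞ |h′(x)|(x^{½−α₀} + x^{½+α₀})dx) + 4(|h_λ(λ)| + 2∫_0^λ |h_λ′|)λ^{−(½−α₀)}/(½−α₀)`,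

where `h = (π²x⁴ − (3/2)πx²)e^{−πx²}` is Riemann's/Connes' Hermite combination (`connesHermiteH`,
`connesHermiteH'` its derivative).  THIS file supplies the limit argument announced there: Fact 6.4
exactly as typed (`prolateGuess_tendsto_riemannXi`: `∀ α₀ ∈ [0,½), ∀ ε > 0, ∃ Λ, ∀ λ ≥ Λ, …`) FOLLOWS
from the two statements of prolate asymptotics

* (E) endpoint decay: `λ · h_λ(λ) → 0` (`λ → ∞`), and
* (W) weighted `W^{1,1}[0,λ]` convergence `h_λ → h`: `∫_0^λ |h_λ′(x) − h′(x)| (1 + x) dx → 0`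
  (`λ → ∞`; the weight `1 + x` dominates every `x^c`, `0 ≤ c ≤ 1`),

both uniformly over all admissible `h_{0,λ}, h_{4,λ}` (which are unique, Slepian–Pollak; uniqueness is
not used): theorem `prolateGuess_tendsto_riemannXi_of_deriv_tendsto`, whose two HYPOTHESES are (E) and
(W) written out (no new named fact is introduced).  (E) and (W) are consequences of the uniform Hermite
asymptotics of the prolate spheroidal wave functions `ps_n(x; γ²)`, `γ = c = 2πλ² → ∞`
(Meixner–Schäfke 1954, §3.2 Satz 9; CCM25 Lemma 7.2(i): `max_{[−λ,λ]} |h_{n,λ} − h_n| = O(λ^{-2})`,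
together with the eigenvalue asymptotics `χ_n(c) = (2n+1)c + O(1)`, Slepian 1965) — in print these
asymptotics are used in exactly this role in the proof of CCM25 Lemma 7.3 — and they are proved with
explicit constants for `λ² ≥ 13` in the connes-x13 bundle (`paper/P1STAR-PROOF.md`, Theorem 1′ and
Lemmas 12–14: `λ²∫_0^λ|(h_λ − h)′|x^a dx ≤ M(a)`; unrefereed outside the bundle).  They are NOT proved
in the tree; the tree now contains the complete, kernel-checked reduction `(E) → (W) → Fact 6.4` of
Connes' Fact 6.4 to pure Sturm–Liouville asymptotics of two prolate functions.  Nothing here concerns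
the Weil quadratic form, its ground state, or RH: THIS IS NOT AN RH STATEMENT.
-/

noncomputable section

open Real Complex Set MeasureTheory Filter Topology intervalIntegral

namespace Literature.NumberTheory.LFunctions

/-- `h′` is integrable on `(0, ∞)`. [folklore] -/
theorem integrableOn_abs_connesHermiteH' :
    IntegrableOn (fun x : ℝ ↦ |connesHermiteH' x|) (Ioi 0) := by
  have h1 : IntegrableOn (fun x : ℝ ↦ |connesHermiteH' x|) (Ioc 0 1) :=
    ((continuous_connesHermiteH'.abs).continuousOn.integrableOn_compact isCompact_Icc).mono_set
      Ioc_subset_Icc_self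
  have h2 : IntegrableOn (fun x : ℝ ↦ |connesHermiteH' x|) (Ioi 1) := by
    have h := (integrableOn_abs_connesHermiteH'_mul_rpow (c := 1) one_pos).mono_set
      (Ioi_subset_Ioi (zero_le_one : (0 : ℝ) ≤ 1))
    refine Integrable.mono' h (continuous_connesHermiteH'.abs).aestronglyMeasurable ?_
    refine (ae_restrict_iff' measurableSet_Ioi).2 (Eventually.of_forall fun x hx ↦ ?_)
    have hx1 : (1 : ℝ) ≤ x := le_of_lt hx
    rw [Real.norm_eq_abs, abs_abs, Real.rpow_one]
    calc |connesHermiteH' x| = |connesHermiteH' x| * 1 := (mul_one _).symm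
      _ ≤ |connesHermiteH' x| * x := mul_le_mul_of_nonneg_left hx1 (abs_nonneg _)
  have h12 := h1.union h2
  rwa [Ioc_union_Ioi_eq_Ioi (zero_le_one : (0 : ℝ) ≤ 1)] at h12

/-- **Connes' Fact 6.4 (= CCM25 Lemma 7.3) from prolate asymptotics.**  If `λ·h_λ(λ) → 0`
(hypothesis `hE`) and `∫_0^λ|h_λ′ − h′|(1+x)dx → 0` (hypothesis `hW`), both as `λ → ∞` uniformly over
the prolate functions `h_{0,λ}, h_{4,λ}` defining `h_λ = prolateGuessH λ h_{0,λ} h_{4,λ}` (these are the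
prolate ↔ Hermite asymptotics of Meixner–Schäfke 1954 §3.2 Satz 9 / CCM25 Lemma 7.2, not proved in the
tree), then `4M_λ(s) → ξ(½+s)` uniformly on every closed substrip `|Re s| ≤ α₀ < ½`, i.e.
`prolateGuess_tendsto_riemannXi` holds.  Proof: the `s`-free bound
`norm_four_mul_prolateGuessMellin_sub_riemannXi_le_W11` (Müntz's formula in the strip, Riemann's
`ξ = 4ζ·𝓜h`, one Mellin integration by parts, Titchmarsh's bound for `ζ(w)/w`, evenness of prolate
functions), in which `x^{½∓α₀} ≤ 1 + x`, `∫_0^λ|h_λ′| ≤ ∫_0^λ|h_λ′ − h′|(1+x) + ∫_0^∞|h′|`, the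
`h′`-tail is a Gaussian tail (`tendsto_integral_Ioi_abs_connesHermiteH'_atTop`) and
`λ^{−(½−α₀)} → 0`.  No RH anywhere. [cite: ConnesConsaniMoscovici2025, Lemma 7.3;
Connes2026Letter, §6.4 Fact 6.4] -/
theorem prolateGuess_tendsto_riemannXi_of_deriv_tendsto
    (hE : ∀ ε : ℝ, 0 < ε → ∃ Λ : ℝ, ∀ lam : ℝ, Λ ≤ lam → ∀ f0 f4 : ℝ → ℝ,
      IsProlateFunction lam 0 f0 → IsProlateFunction lam 4 f4 →
        |prolateGuessH lam f0 f4 lam| * lam ≤ ε)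
    (hW : ∀ ε : ℝ, 0 < ε → ∃ Λ : ℝ, ∀ lam : ℝ, Λ ≤ lam → ∀ f0 f4 : ℝ → ℝ,
      IsProlateFunction lam 0 f0 → IsProlateFunction lam 4 f4 →
        (∫ x in (0 : ℝ)..lam, |deriv (prolateGuessH lam f0 f4) x - connesHermiteH' x| * (1 + x))
          ≤ ε) :
    prolateGuess_tendsto_riemannXi := by
  intro α₀ hα hα' ε hε
  have ha : 0 < 1 / 2 - α₀ := by linarith
  have ha1 : 1 / 2 - α₀ ≤ 1 := by linarith
  have hb : 0 < 1 / 2 + α₀ := by linarith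
  have hb1 : 1 / 2 + α₀ ≤ 1 := by linarith
  have hq : 0 < 1 / 4 - α₀ ^ 2 := by nlinarith
  have hK : 0 < 4 / (1 / 4 - α₀ ^ 2) := by positivity
  -- `I₁ = ∫_0^∞ |h′|`, `B` = the eventual bound for `|h_λ(λ)| + 2∫_0^λ|h_λ′|`
  have hI₁ : 0 ≤ ∫ x in Ioi (0 : ℝ), |connesHermiteH' x| :=
    setIntegral_nonneg measurableSet_Ioi fun x _ ↦ abs_nonneg _
  have hB : 0 < 1 + 2 * (1 + ∫ x in Ioi (0 : ℝ), |connesHermiteH' x|) := by positivity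
  -- the five eventualities in `λ`
  have E0 : ∀ᶠ lam : ℝ in atTop, 1 ≤ lam := eventually_ge_atTop 1
  have E1 : ∀ᶠ lam : ℝ in atTop, ∀ f0 f4 : ℝ → ℝ, IsProlateFunction lam 0 f0 →
      IsProlateFunction lam 4 f4 →
        |prolateGuessH lam f0 f4 lam| * lam ≤ min 1 (ε / (4 * (4 / (1 / 4 - α₀ ^ 2)))) := by
    obtain ⟨Λ, hΛ⟩ := hE (min 1 (ε / (4 * (4 / (1 / 4 - α₀ ^ 2)))))
      (lt_min one_pos (by positivity))
    exact eventually_atTop.2 ⟨Λ, hΛ⟩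
  have E2 : ∀ᶠ lam : ℝ in atTop, ∀ f0 f4 : ℝ → ℝ, IsProlateFunction lam 0 f0 →
      IsProlateFunction lam 4 f4 →
        (∫ x in (0 : ℝ)..lam, |deriv (prolateGuessH lam f0 f4) x - connesHermiteH' x| * (1 + x))
          ≤ min 1 (ε / (8 * (4 / (1 / 4 - α₀ ^ 2)))) := by
    obtain ⟨Λ, hΛ⟩ := hW (min 1 (ε / (8 * (4 / (1 / 4 - α₀ ^ 2)))))
      (lt_min one_pos (by positivity))
    exact eventually_atTop.2 ⟨Λ, hΛ⟩
  have E3 : ∀ᶠ lam : ℝ in atTop,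
      (∫ x in Ioi lam, |connesHermiteH' x| * (x ^ (1 / 2 - α₀) + x ^ (1 / 2 + α₀)))
        < ε / (4 * (4 / (1 / 4 - α₀ ^ 2))) :=
    (tendsto_integral_Ioi_abs_connesHermiteH'_atTop ha hb).eventually (gt_mem_nhds (by positivity))
  have E4 : ∀ᶠ lam : ℝ in atTop, lam ^ (-(1 / 2 - α₀))
      < ε * (1 / 2 - α₀) / (16 * (1 + 2 * (1 + ∫ x in Ioi (0 : ℝ), |connesHermiteH' x|))) :=
    (tendsto_rpow_neg_atTop ha).eventually (gt_mem_nhds (by positivity))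
  obtain ⟨Λ, hΛ⟩ := eventually_atTop.1 (E0.and (E1.and (E2.and (E3.and E4))))
  refine ⟨Λ, fun lam hlam f0 f4 h0 h4 s hs ↦ ?_⟩
  obtain ⟨hlam1, hE', hW', hT, hP⟩ := hΛ lam hlam
  have hlam0 : 0 < lam := by linarith
  have hEnd := hE' f0 f4 h0 h4
  have hWt := hW' f0 f4 h0 h4
  clear hE' hW'
  have main := norm_four_mul_prolateGuessMellin_sub_riemannXi_le_W11 h0 h4 hlam1 hα hα' hs
  -- integrability bookkeeping on `[0, λ]`
  obtain ⟨-, hdi⟩ := prolateGuessH_hasDerivAt h0 h4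
  have ih : IntervalIntegrable (fun x ↦ |connesHermiteH' x|) volume 0 lam :=
    (continuous_connesHermiteH'.intervalIntegrable 0 lam).abs
  have i_diff : IntervalIntegrable
      (fun x ↦ |deriv (prolateGuessH lam f0 f4) x - connesHermiteH' x|) volume 0 lam :=
    (hdi.sub (continuous_connesHermiteH'.intervalIntegrable 0 lam)).abs
  have i_W : IntervalIntegrable
      (fun x ↦ |deriv (prolateGuessH lam f0 f4) x - connesHermiteH' x| * (1 + x)) volume 0 lam :=
    i_diff.mul_continuousOn (by fun_prop)
  have i_W2 : IntervalIntegrable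
      (fun x ↦ |deriv (prolateGuessH lam f0 f4) x - connesHermiteH' x| * (2 * (1 + x)))
        volume 0 lam :=
    i_diff.mul_continuousOn (by fun_prop)
  have i_ab : IntervalIntegrable
      (fun x ↦ |deriv (prolateGuessH lam f0 f4) x - connesHermiteH' x|
        * (x ^ (1 / 2 - α₀) + x ^ (1 / 2 + α₀))) volume 0 lam :=
    i_diff.mul_continuousOn
      ((Real.continuous_rpow_const ha.le).add (Real.continuous_rpow_const hb.le)).continuousOn
  -- (1) the weighted derivative term: `x^{½−α₀} + x^{½+α₀} ≤ 2(1 + x)` (`x^e ≤ 1 + x` for `x ≥ 0`,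
  -- `0 ≤ e ≤ 1`; cf. `Literature.Analysis.PDE.rpow_le_one_add`, not imported to keep the import graph small)
  have rpow_le : ∀ {x e : ℝ}, 0 ≤ x → 0 ≤ e → e ≤ 1 → x ^ e ≤ 1 + x := by
    intro x e hx he₀ he₁
    rcases le_or_gt x 1 with h | h
    · exact (Real.rpow_le_one hx h he₀).trans (by linarith)
    · exact (Real.rpow_le_self_of_one_le h.le he₁).trans (by linarith)
  have h2 : (∫ x in (0 : ℝ)..lam, |deriv (prolateGuessH lam f0 f4) x - connesHermiteH' x|
        * (x ^ (1 / 2 - α₀) + x ^ (1 / 2 + α₀)))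
      ≤ 2 * ∫ x in (0 : ℝ)..lam,
          |deriv (prolateGuessH lam f0 f4) x - connesHermiteH' x| * (1 + x) := by
    calc _ ≤ ∫ x in (0 : ℝ)..lam,
          |deriv (prolateGuessH lam f0 f4) x - connesHermiteH' x| * (2 * (1 + x)) := by
          refine intervalIntegral.integral_mono_on hlam0.le i_ab i_W2 (fun x hx ↦ ?_)
          have hx0 : 0 ≤ x := hx.1
          have e1 := rpow_le hx0 ha.le ha1
          have e2 := rpow_le hx0 hb.le hb1
          exact mul_le_mul_of_nonneg_left (by linarith) (abs_nonneg _)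
      _ = 2 * ∫ x in (0 : ℝ)..lam,
          |deriv (prolateGuessH lam f0 f4) x - connesHermiteH' x| * (1 + x) := by
          rw [← intervalIntegral.integral_const_mul]
          congr 1
          ext x
          ring
  -- (2) `∫_0^λ |h_λ′| ≤ ∫_0^λ |h_λ′ − h′|(1 + x) + ∫_0^∞ |h′|`
  have hD : (∫ x in (0 : ℝ)..lam, |deriv (prolateGuessH lam f0 f4) x|)
      ≤ (∫ x in (0 : ℝ)..lam, |deriv (prolateGuessH lam f0 f4) x - connesHermiteH' x| * (1 + x))
        + ∫ x in Ioi (0 : ℝ), |connesHermiteH' x| := by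
    have step1 : (∫ x in (0 : ℝ)..lam, |deriv (prolateGuessH lam f0 f4) x|)
        ≤ ∫ x in (0 : ℝ)..lam,
          (|deriv (prolateGuessH lam f0 f4) x - connesHermiteH' x| * (1 + x)
            + |connesHermiteH' x|) := by
      refine intervalIntegral.integral_mono_on hlam0.le hdi.abs (i_W.add ih) (fun x hx ↦ ?_)
      have hx0 : 0 ≤ x := hx.1
      have hd0 : 0 ≤ |deriv (prolateGuessH lam f0 f4) x - connesHermiteH' x| := abs_nonneg _
      calc |deriv (prolateGuessH lam f0 f4) x|
          = |(deriv (prolateGuessH lam f0 f4) x - connesHermiteH' x) + connesHermiteH' x| := by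
            ring_nf
        _ ≤ |deriv (prolateGuessH lam f0 f4) x - connesHermiteH' x| + |connesHermiteH' x| :=
            abs_add_le _ _
        _ ≤ |deriv (prolateGuessH lam f0 f4) x - connesHermiteH' x| * (1 + x)
              + |connesHermiteH' x| := by nlinarith
    have step2 : (∫ x in (0 : ℝ)..lam,
          (|deriv (prolateGuessH lam f0 f4) x - connesHermiteH' x| * (1 + x)
            + |connesHermiteH' x|))
        = (∫ x in (0 : ℝ)..lam,
            |deriv (prolateGuessH lam f0 f4) x - connesHermiteH' x| * (1 + x))
          + ∫ x in (0 : ℝ)..lam, |connesHermiteH' x| :=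
      intervalIntegral.integral_add i_W ih
    have step3 : (∫ x in (0 : ℝ)..lam, |connesHermiteH' x|)
        ≤ ∫ x in Ioi (0 : ℝ), |connesHermiteH' x| := by
      rw [intervalIntegral.integral_of_le hlam0.le]
      exact setIntegral_mono_set integrableOn_abs_connesHermiteH'
        (ae_of_all _ fun x ↦ abs_nonneg _) Ioc_subset_Ioi_self.eventuallyLE
    linarith
  -- (3) assemble
  have hEnd1 : |prolateGuessH lam f0 f4 lam| * lam ≤ ε / (4 * (4 / (1 / 4 - α₀ ^ 2))) :=
    hEnd.trans (min_le_right _ _)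
  have hEnd2 : |prolateGuessH lam f0 f4 lam| ≤ 1 := by
    have h1 : |prolateGuessH lam f0 f4 lam| * lam ≤ 1 := hEnd.trans (min_le_left _ _)
    have h0 : 0 ≤ |prolateGuessH lam f0 f4 lam| := abs_nonneg _
    nlinarith
  have hW1 : (∫ x in (0 : ℝ)..lam,
      |deriv (prolateGuessH lam f0 f4) x - connesHermiteH' x| * (1 + x)) ≤ 1 :=
    hWt.trans (min_le_left _ _)
  have hW2 : (∫ x in (0 : ℝ)..lam,
      |deriv (prolateGuessH lam f0 f4) x - connesHermiteH' x| * (1 + x))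
        ≤ ε / (8 * (4 / (1 / 4 - α₀ ^ 2))) :=
    hWt.trans (min_le_right _ _)
  -- the bracket of the main term
  have hbr : |prolateGuessH lam f0 f4 lam| * lam
        + (∫ x in (0 : ℝ)..lam, |deriv (prolateGuessH lam f0 f4) x - connesHermiteH' x|
            * (x ^ (1 / 2 - α₀) + x ^ (1 / 2 + α₀)))
        + (∫ x in Ioi lam, |connesHermiteH' x| * (x ^ (1 / 2 - α₀) + x ^ (1 / 2 + α₀)))
      ≤ 3 * (ε / (4 * (4 / (1 / 4 - α₀ ^ 2)))) := by
    have : ε / (8 * (4 / (1 / 4 - α₀ ^ 2))) = (ε / (4 * (4 / (1 / 4 - α₀ ^ 2)))) / 2 := by ring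
    linarith [hT.le]
  have hmainterm : 4 / (1 / 4 - α₀ ^ 2) * (|prolateGuessH lam f0 f4 lam| * lam
        + (∫ x in (0 : ℝ)..lam, |deriv (prolateGuessH lam f0 f4) x - connesHermiteH' x|
            * (x ^ (1 / 2 - α₀) + x ^ (1 / 2 + α₀)))
        + (∫ x in Ioi lam, |connesHermiteH' x| * (x ^ (1 / 2 - α₀) + x ^ (1 / 2 + α₀))))
      ≤ 3 * ε / 4 := by
    calc _ ≤ 4 / (1 / 4 - α₀ ^ 2) * (3 * (ε / (4 * (4 / (1 / 4 - α₀ ^ 2))))) :=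
          mul_le_mul_of_nonneg_left hbr hK.le
      _ = 3 * ε / 4 * ((4 / (1 / 4 - α₀ ^ 2)) / (4 / (1 / 4 - α₀ ^ 2))) := by ring
      _ = 3 * ε / 4 := by rw [div_self hK.ne', mul_one]
  -- the boundary term
  have hcoef : |prolateGuessH lam f0 f4 lam|
        + 2 * (∫ x in (0 : ℝ)..lam, |deriv (prolateGuessH lam f0 f4) x|)
      ≤ 1 + 2 * (1 + ∫ x in Ioi (0 : ℝ), |connesHermiteH' x|) := by linarith
  have hpow0 : 0 ≤ lam ^ (-(1 / 2 - α₀)) := Real.rpow_nonneg hlam0.le _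
  have hbdry : 4 * ((|prolateGuessH lam f0 f4 lam|
        + 2 * ∫ x in (0 : ℝ)..lam, |deriv (prolateGuessH lam f0 f4) x|)
          * lam ^ (-(1 / 2 - α₀)) / (1 / 2 - α₀)) ≤ ε / 4 := by
    have s1 : (|prolateGuessH lam f0 f4 lam|
          + 2 * ∫ x in (0 : ℝ)..lam, |deriv (prolateGuessH lam f0 f4) x|)
            * lam ^ (-(1 / 2 - α₀))
        ≤ (1 + 2 * (1 + ∫ x in Ioi (0 : ℝ), |connesHermiteH' x|)) * lam ^ (-(1 / 2 - α₀)) :=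
      mul_le_mul_of_nonneg_right hcoef hpow0
    have s2 : (1 + 2 * (1 + ∫ x in Ioi (0 : ℝ), |connesHermiteH' x|)) * lam ^ (-(1 / 2 - α₀))
        ≤ (1 + 2 * (1 + ∫ x in Ioi (0 : ℝ), |connesHermiteH' x|))
          * (ε * (1 / 2 - α₀)
            / (16 * (1 + 2 * (1 + ∫ x in Ioi (0 : ℝ), |connesHermiteH' x|)))) :=
      mul_le_mul_of_nonneg_left hP.le hB.le
    have s3 : (1 + 2 * (1 + ∫ x in Ioi (0 : ℝ), |connesHermiteH' x|))
          * (ε * (1 / 2 - α₀)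
            / (16 * (1 + 2 * (1 + ∫ x in Ioi (0 : ℝ), |connesHermiteH' x|))))
        = ε * (1 / 2 - α₀) / 16 := by
      field_simp
    have s4 : (|prolateGuessH lam f0 f4 lam|
          + 2 * ∫ x in (0 : ℝ)..lam, |deriv (prolateGuessH lam f0 f4) x|)
            * lam ^ (-(1 / 2 - α₀)) ≤ ε * (1 / 2 - α₀) / 16 := by linarith
    have s5 : (|prolateGuessH lam f0 f4 lam|
          + 2 * ∫ x in (0 : ℝ)..lam, |deriv (prolateGuessH lam f0 f4) x|)
            * lam ^ (-(1 / 2 - α₀)) / (1 / 2 - α₀) ≤ (ε * (1 / 2 - α₀) / 16) / (1 / 2 - α₀) :=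
      div_le_div_of_nonneg_right s4 ha.le
    have s6 : (ε * (1 / 2 - α₀) / 16) / (1 / 2 - α₀) = ε / 16 := by
      calc (ε * (1 / 2 - α₀) / 16) / (1 / 2 - α₀) = ε / 16 * ((1 / 2 - α₀) / (1 / 2 - α₀)) := by
            ring
        _ = ε / 16 := by rw [div_self ha.ne', mul_one]
    linarith
  linarith

end Literature.NumberTheory.LFunctions
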